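import Summits.CriticalPhenomena.PercolationContinuityZ3.Theses.PercNonProliferation
import Summits.CriticalPhenomena.PercolationContinuityZ3.Theorems.PercBoundarySqueezeBoundaryArmCount
import HarnessLib

/-!
# Crux `PercNonProliferation.FreeBoxPowerSaving` (stmt-CriticalPhenomena-4447), line
# `boundary-interior-split-fat-finite-clusters` — stub `stub_bdryQuasiGiant_le_wall`

Helper file for the checked skeleton of the crux `FreeBoxPowerSaving` (route
`PercNonProliferation`), line `boundary-interior-split-fat-finite-clusters`.  Proves exactly the
registered stub signature `stub_bdryQuasiGiant_le_wall` (boundary quasi-giants are controlled by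
the floor-rooted half-space cluster); lands with `--supports stmt-CriticalPhenomena-4447`.

## The statement

Bond percolation `P_p` on `ℤ³`, free box `Λ_n = box 3 n`, doubled box `Λ_{2n} = box 3 (2n)`,
half-space `ℍ = {x | 0 ≤ x₀}`.  For `u ∈ Λ_n` the PIECE of `u` is
`piece(u) = {v ∈ Λ_n : u ↔ v by an open path inside Λ_n}`.  For every `p`, `n` and real `s`:

`P_p(∃ u ∈ ∂ⁱⁿΛ_n, s ≤ #piece(u)) ≤ 6 (2n+1)² · P_p(s ≤ #{y ∈ Λ_{2n} : 0 ↔ y inside ℍ})`.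

## The argument (pure lattice-symmetry bookkeeping, every `p`)

1. Union bound over `v ∈ ∂ⁱⁿΛ_n` (`measureReal_biUnion_finset_le`) and
   `|∂ⁱⁿΛ_n| ≤ 6 (2n+1)²` (`percBoundarySqueeze_card_innerBoundary_box_three_le`).
2. Per-vertex bound (`real_piece_ge_le_wall`, the analogue of the landed
   `percBoundarySqueeze_real_boundary_core_le`): a site `v ∈ ∂ⁱⁿΛ_n` lies on a face
   `{x_i = ±n}` (`exists_eq_of_mem_innerBoundary_box`).  The lattice automorphism
   `ψ = σ ∘ (· - v)`, `σ` the signed coordinate permutation exchanging the axes `i` and `0` with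
   sign `∓` (`zdShiftIso`, `zdSignedPermIso`), maps `v ↦ 0`, the box `Λ_n` into `ℍ`, and — since
   `Λ_n - v ⊆ Λ_{2n}` and signed permutations preserve boxes (`signedPerm_mem_box_iff`) — into
   `Λ_{2n}`.  Restricted connection events are transported along `ψ` (`relabel_mem_openConnIn`,
   `openConnIn_mono`), so `ψ` maps `piece(v)(ω)` injectively into
   `{y ∈ Λ_{2n} : 0 ↔ y inside ℍ}(ψ ω)`; hence
   `{s ≤ #piece(v)} ⊆ (ψ '' ·)⁻¹ {s ≤ #{y ∈ Λ_{2n} : 0 ↔_ℍ y}}`, and `P_p` is `ψ`-invariant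
   (`bondPercolation_real_preimage_relabel_iso`; Grimmett 1999, §1.6).

Degenerate parameters need no special treatment (`n = 0`, `s ≤ 0`, `p ∈ {0, 1}`): the bound is an
inclusion of events followed by a union bound.

No new definitions: the events are written out as set-builder expressions exactly as registered.
-/

noncomputable section

open MeasureTheory Filter
open Literature.Probability.Percolation Literature.Probability.LatticeModels
open scoped Topology Classical BigOperators

namespace Summit.CriticalPhenomena.PercolationContinuityZ3.FreeBoxPowerSavingLine

namespace BdryQuasiGiantLeWall

/-- **Per-vertex symmetry bound.** For `v ∈ ∂ⁱⁿΛ_n`, any parameter `p` and any real `s`,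
`P_p(s ≤ #piece(v)) ≤ P_p(s ≤ #{y ∈ Λ_{2n} : 0 ↔ y inside ℍ})`: the lattice automorphism
`y ↦ σ(y - v)` (with `σ` the signed coordinate permutation exchanging the axes `i` and `0`, `v` on
the face `{x_i = ±n}`) maps `v ↦ 0` and `Λ_n` into `ℍ ∩ Λ_{2n}`, hence carries the `Λ_n`-piece of
`v` injectively into `{y ∈ Λ_{2n} : 0 ↔ y inside ℍ}` of the relabelled configuration, and `P_p` is
invariant (Grimmett 1999, §1.6, invariance of `P_p` under lattice automorphisms). [folklore] -/
theorem real_piece_ge_le_wall (p : unitInterval) (n : ℕ) (s : ℝ) {v : Site 3}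
    (hv : v ∈ innerBoundary (zdGraph 3) (box 3 n)) :
    (bondPercolation (zdGraph 3) p).real
        {ω | s ≤ (((box 3 n).filter fun w => ω ∈ openConnIn ↑(box 3 n) v w).card : ℝ)} ≤
      (bondPercolation (zdGraph 3) p).real
        {ω | s ≤ (((box 3 (2 * n)).filter fun y =>
          ω ∈ openConnIn {x : Site 3 | 0 ≤ x 0} (0 : Site 3) y).card : ℝ)} := by
  obtain ⟨i, hi⟩ := exists_eq_of_mem_innerBoundary_box hv
  have hvbox : v ∈ box 3 n := (mem_innerBoundary_iff.1 hv).1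
  -- the sign of the reflection: the box lies on the nonnegative side of the face through `v`
  obtain ⟨ε, hεbox⟩ : ∃ ε : ℤˣ, ∀ y ∈ box 3 n, 0 ≤ (ε : ℤ) * (y i - v i) := by
    rcases hi with hvi | hvi
    · refine ⟨-1, fun y hy => ?_⟩
      have := (mem_box.1 hy i).2
      rw [hvi]; push_cast; linarith
    · refine ⟨1, fun y hy => ?_⟩
      have := (mem_box.1 hy i).1
      rw [hvi]; push_cast; linarith
  -- the automorphism `ψ y = σ (y - v)`
  set π : Equiv.Perm (Fin 3) := Equiv.swap i 0 with hπ
  set ψ : zdGraph 3 ≃g zdGraph 3 := (zdShiftIso (-v)).trans (zdSignedPermIso π fun _ => ε) with hψ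
  set e : Site 3 ≃ Site 3 := ψ.toEquiv with he
  have he_apply : ∀ y, e y = Site.signedPerm π (fun _ => ε) (y + -v) := fun y => rfl
  have he0 : ∀ y, e y 0 = (ε : ℤ) * (y i - v i) := fun y => by
    rw [he_apply, Site.signedPerm_apply, hπ, Equiv.symm_swap, Equiv.swap_apply_right]
    simp [sub_eq_add_neg]
  have hev : e v = 0 := by rw [he_apply, add_neg_cancel, Site.signedPerm_zero]
  -- `ψ(Λ_n) ⊆ ℍ`
  have himg : e '' (↑(box 3 n) : Set (Site 3)) ⊆ {x : Site 3 | 0 ≤ x 0} := by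
    rintro _ ⟨y, hy, rfl⟩
    show 0 ≤ e y 0
    rw [he0]
    exact hεbox y hy
  -- `ψ(Λ_n) ⊆ Λ_{2n}`
  have hbox2 : ∀ y ∈ box 3 n, e y ∈ box 3 (2 * n) := by
    intro y hy
    rw [he_apply, signedPerm_mem_box_iff]
    have hv' := hvbox
    rw [mem_box] at hy hv' ⊢
    intro j
    have h1 := hy j
    have h2 := hv' j
    simp only [Pi.add_apply, Pi.neg_apply]
    push_cast
    omega
  -- the inclusion of events
  have hsub : {ω | s ≤ (((box 3 n).filter fun w => ω ∈ openConnIn ↑(box 3 n) v w).card : ℝ)} ⊆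
      BondConfig.relabel (sym2Equiv e) ⁻¹'
        {ω | s ≤ (((box 3 (2 * n)).filter fun y =>
          ω ∈ openConnIn {x : Site 3 | 0 ≤ x 0} (0 : Site 3) y).card : ℝ)} := by
    intro ω hω
    have hcard : ((box 3 n).filter fun w => ω ∈ openConnIn ↑(box 3 n) v w).card ≤
        ((box 3 (2 * n)).filter fun y => BondConfig.relabel (sym2Equiv e) ω ∈
          openConnIn {x : Site 3 | 0 ≤ x 0} (0 : Site 3) y).card := by
      calc ((box 3 n).filter fun w => ω ∈ openConnIn ↑(box 3 n) v w).card
          = (((box 3 n).filter fun w => ω ∈ openConnIn ↑(box 3 n) v w).image e).card :=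
            (Finset.card_image_of_injective _ e.injective).symm
        _ ≤ _ := Finset.card_le_card ?_
      intro y hy
      obtain ⟨w, hw, rfl⟩ := Finset.mem_image.1 hy
      obtain ⟨hwbox, hwconn⟩ := Finset.mem_filter.1 hw
      refine Finset.mem_filter.2 ⟨hbox2 w hwbox, ?_⟩
      have h1 := relabel_mem_openConnIn e hwconn
      rw [hev] at h1
      exact openConnIn_mono himg _ _ h1
    have hω' : s ≤ (((box 3 n).filter fun w => ω ∈ openConnIn ↑(box 3 n) v w).card : ℝ) := hω
    show s ≤ (((box 3 (2 * n)).filter fun y => BondConfig.relabel (sym2Equiv e) ω ∈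
      openConnIn {x : Site 3 | 0 ≤ x 0} (0 : Site 3) y).card : ℝ)
    exact hω'.trans (by exact_mod_cast hcard)
  calc (bondPercolation (zdGraph 3) p).real
        {ω | s ≤ (((box 3 n).filter fun w => ω ∈ openConnIn ↑(box 3 n) v w).card : ℝ)}
      ≤ (bondPercolation (zdGraph 3) p).real (BondConfig.relabel (sym2Equiv e) ⁻¹'
          {ω | s ≤ (((box 3 (2 * n)).filter fun y =>
            ω ∈ openConnIn {x : Site 3 | 0 ≤ x 0} (0 : Site 3) y).card : ℝ)}) :=
        measureReal_mono hsub (measure_ne_top _ _)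
    _ = (bondPercolation (zdGraph 3) p).real
          {ω | s ≤ (((box 3 (2 * n)).filter fun y =>
            ω ∈ openConnIn {x : Site 3 | 0 ≤ x 0} (0 : Site 3) y).card : ℝ)} := by
        rw [he, bondPercolation_real_preimage_relabel_iso ψ p]

end BdryQuasiGiantLeWall

open BdryQuasiGiantLeWall

/-- **stub_bdryQuasiGiant_le_wall (boundary quasi-giants are controlled by the floor-rooted
half-space cluster; every `p`, every `n`, every real `s`).**
`P_p(some piece of Λ_n touching ∂ⁱⁿΛ_n has ≥ s vertices)
   ≤ 6 (2n+1)² · P_p(s ≤ #{y ∈ Λ_{2n} : 0 ↔ y inside ℍ})`, `ℍ = {x | 0 ≤ x₀}`.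
Proof: union bound over `v ∈ ∂ⁱⁿΛ_n` (`|∂ⁱⁿΛ_n| ≤ 6(2n+1)²`,
`percBoundarySqueeze_card_innerBoundary_box_three_le`) and the per-vertex symmetry bound
`real_piece_ge_le_wall` (lattice-symmetry transport to the floor-rooted half-space cluster;
Grimmett 1999, §1.6). [folklore] -/
theorem stub_bdryQuasiGiant_le_wall :
    ∀ (p : unitInterval) (n : ℕ) (s : ℝ),
      (bondPercolation (zdGraph 3) p).real
          {ω | ∃ u ∈ innerBoundary (zdGraph 3) (box 3 n),
            s ≤ (((box 3 n).filter fun v => ω ∈ openConnIn ↑(box 3 n) u v).card : ℝ)}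
        ≤ 6 * (2 * (n : ℝ) + 1) ^ 2 *
          (bondPercolation (zdGraph 3) p).real
            {ω | s ≤ (((box 3 (2 * n)).filter fun y =>
              ω ∈ openConnIn {x : Site 3 | 0 ≤ x 0} (0 : Site 3) y).card : ℝ)} := by
  intro p n s
  set P := bondPercolation (zdGraph 3) p with hP
  set B : Set (BondConfig (Site 3)) := {ω | s ≤ (((box 3 (2 * n)).filter fun y =>
    ω ∈ openConnIn {x : Site 3 | 0 ≤ x 0} (0 : Site 3) y).card : ℝ)} with hB
  have hU : {ω : BondConfig (Site 3) | ∃ u ∈ innerBoundary (zdGraph 3) (box 3 n),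
        s ≤ (((box 3 n).filter fun v => ω ∈ openConnIn ↑(box 3 n) u v).card : ℝ)} =
      ⋃ u ∈ innerBoundary (zdGraph 3) (box 3 n),
        {ω | s ≤ (((box 3 n).filter fun v => ω ∈ openConnIn ↑(box 3 n) u v).card : ℝ)} := by
    ext ω
    simp only [Set.mem_setOf_eq, Set.mem_iUnion, exists_prop]
  rw [hU]
  calc P.real (⋃ u ∈ innerBoundary (zdGraph 3) (box 3 n),
          {ω | s ≤ (((box 3 n).filter fun v => ω ∈ openConnIn ↑(box 3 n) u v).card : ℝ)})
      ≤ ∑ u ∈ innerBoundary (zdGraph 3) (box 3 n),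
          P.real {ω | s ≤ (((box 3 n).filter fun v => ω ∈ openConnIn ↑(box 3 n) u v).card : ℝ)} :=
        measureReal_biUnion_finset_le _ _
    _ ≤ ∑ _u ∈ innerBoundary (zdGraph 3) (box 3 n), P.real B :=
        Finset.sum_le_sum fun u hu => real_piece_ge_le_wall p n s hu
    _ = (innerBoundary (zdGraph 3) (box 3 n)).card * P.real B := by
        rw [Finset.sum_const, nsmul_eq_mul]
    _ ≤ 6 * (2 * (n : ℝ) + 1) ^ 2 * P.real B :=
        mul_le_mul_of_nonneg_right
          (Theorems.percBoundarySqueeze_card_innerBoundary_box_three_le n) measureReal_nonneg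

end Summit.CriticalPhenomena.PercolationContinuityZ3.FreeBoxPowerSavingLine

end
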